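import Mathlib
import Summits.ResolutionOfSingularities.ResolutionOfSingularities.Theorems.WeightedInvariantLocalWeightedDropTwistedTrivialTransport
import Summits.ResolutionOfSingularities.ResolutionOfSingularities.Theorems.WeightedInvariantLocalWeightedDropTwistedTrivialCylinderDescent
import Summits.ResolutionOfSingularities.ResolutionOfSingularities.Theorems.WeightedInvariantLocalWeightedDropTwistedTrivialWitnesses
import Summits.ResolutionOfSingularities.ResolutionOfSingularities.Theorems.WeightedInvariantLocalWeightedDropGradedSliceTwistedSaturation
import Summits.ResolutionOfSingularities.ResolutionOfSingularities.Theorems.WeightedInvariantLocalWeightedDropGradedSliceWildSupport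

/-!
# `WeightedInvariant.LocalWeightedDrop`: «COVER EXACT» — the Fix-saturated axis directions of the Frobenius-cover normal form

Route `ResolutionOfSingularities/WeightedInvariant`, crux `LocalWeightedDrop` (stmt-ResolutionOfSingularities-8899); card A
of crux `WeightedConstruction` (stmt-ResolutionOfSingularities-0571).  [OURS · L1 W4.3] — res-type-099 (gen 13), item (a)
of ideator res-L1-w43-idea-1's ROUND-6 MENU (card A R5.10): «type `Θ = (D_t x, t)` as a coordinate change and prove COVER
EXACT `satDir p G̃ = {t} ∪ castSucc(satDir p h)` (kernel, from v4 + R5.9)» — the PREDICATE-LEVEL TREE VERSION (no `satDir`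
object is typed under `Theorems/` yet); idea-1's simultaneous sketch-level proof is §11c-7 `satDir_cover_exact` of
`Sketch-L1-idea-1.lean` v5-final-3 (sha16 10fe4df2ba9a969e, ADDENDUM 3 2026-08-27T13:15:45Z), whose `satDir_subst_axes`
(invariance under general axis-preserving frames) is NOT reproduced here.  Nothing here is a statement of the manuscript under
review on ladder RESOLUTION; AI-produced, weaker than expert review.

THE STATEMENT (`twistedTrivialAlongFix_coverForm_axis_iff`, `p ≠ 0`).  For the Frobenius-cover normal form
`G̃ = (1 + t)ᵃ · h((1+t)^{Kᵢ} xᵢ)` (`t = X last`; res-type-060's TC(G, h, K, a) of `…GradedSliceTwistedSuccessor`, the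
right-hand side of `subst (frobFamily n q) G = (1 + X last)^a * subst (scaleFam K) h`), the tree predicate
`TwistedTrivialAlongFix p G̃ (axisCurve w)` holds iff `w = t` or `w = xᵢ` with `TwistedTrivialAlongFix p h (axisCurve i)`.
PROOF = three rules of record: the UNIT RULE `twistedTrivialAlongFix_unit_mul_iff` (`…TwistedTrivialWitnesses`) removes
`(1+t)ᵃ`; `h((1+t)^K x) = (cylinder h) ∘ Θ_K` for the DIAGONAL FRAME `Θ_K = (D_t x, t) = Fin.snoc (scaleFam K) (X last)`
(res-type-060's pre-scaling of `…GradedSliceTwistedSaturation`: zero constants, `lin Θ_K = 1`), so the TRANSPORT RULE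
`twistedTrivialAlongFix_subst_iff` (R5.9, `…TwistedTrivialTransport`) moves the question to `cylinder h` along
`Θ_K ∘ axisCurve w = axisCurve w` (`subst_axisCurve_snoc_scaleFam`: the axis curves are `Θ_K`-stable); the CYLINDER RULE
`twistedTrivialAlongFix_cylinder_iff` (`…TwistedTrivialCylinderDescent`) finishes.

AT THE WILD POINT (`twistedTrivialAlongFix_wildCover_axis_iff`): with the repaired minimal-valuation hypotheses of the wild
slice clause (frozen coordinate `v` = last, `q ∣ w_v`, `q ∣ wⱼ` on the translated `j ≠ v`, `(1 + y_v)^q = 1 + y_v^q`), the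
pull-back `(g ∘ Λ_q)(…, y_v^q)` of the renormalised successor to the `μ_q`-cover is Fix-trivial along the `y`-axis of
direction `u` iff `u = v` or `u = castSucc i` with the SLICE `g|_{y_v = 0}` Fix-trivial along `i` — by
`subst_frobFamily_wildLambda_eq_scaleFam` (`…GradedSliceWildSupport`).  This is the EXACT statement «upstairs»; the
descent to `g ∘ Λ_q` itself (idea-1's conjecture C″, ⊆ half) is NOT claimed here.
-/

set_option linter.dupNamespace false -- mandated namespace of this single-conjunct summit
set_option autoImplicit false

namespace Summit.ResolutionOfSingularities.ResolutionOfSingularities.Theorems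

namespace GradedGame

open MvPowerSeries
open Literature.AlgebraicGeometry.Resolution
open Literature.AlgebraicGeometry.Resolution.FormalCoordChange (linMat)

variable {k : Type} [Field k]

variable {n : ℕ}

/-! ## The diagonal frame `Θ_K = (D_t x, t)` and the axis curves -/

/-- `h((1+t)^K x) = (cylinder h) ∘ Θ_K` for the diagonal frame `Θ_K = Fin.snoc (scaleFam K) (X last)`. [OURS · L1 W4.3] -/
theorem subst_snoc_scaleFam_cylinder (K : Fin (n + 1) → ℕ) (h : MvPowerSeries (Fin (n + 1)) k) :
    subst (Fin.snoc (scaleFam (k := k) K) (X (Fin.last (n + 1))) :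
        Fin (n + 1 + 1) → MvPowerSeries (Fin (n + 1 + 1)) k) (cylinder h) = subst (scaleFam (k := k) K) h := by
  rw [subst_cylinder (hasSubst_snoc_scaleFam K)]
  congr 1
  funext j
  rw [Fin.snoc_castSucc]

/-- The axis curves have no constant terms. [OURS · L1 W4.3] -/
theorem constantCoeff_axisCurve {m : ℕ} (w l : Fin m) : constantCoeff (axisCurve (k := k) w l) = 0 := by
  unfold axisCurve; split_ifs <;> simp

/-- The axis curves are substitutable. [OURS · L1 W4.3] -/
theorem hasSubst_axisCurve {m : ℕ} (w : Fin m) : HasSubst (axisCurve (k := k) w) :=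
  hasSubst_of_constantCoeff_zero (constantCoeff_axisCurve w)

/-- THE AXIS CURVES ARE `Θ_K`-STABLE: `Θ_K ∘ axisCurve w = axisCurve w` for every coordinate direction `w` (on the `t`-axis
`x = 0`; on an `xᵢ`-axis `t = 0`, so `(1+t)^K = 1`). [OURS · L1 W4.3] -/
theorem subst_axisCurve_snoc_scaleFam (K : Fin (n + 1) → ℕ) (w : Fin (n + 1 + 1)) :
    (fun i => subst (axisCurve (k := k) w) ((Fin.snoc (scaleFam (k := k) K) (X (Fin.last (n + 1))) :
        Fin (n + 1 + 1) → MvPowerSeries (Fin (n + 1 + 1)) k) i)) = axisCurve w := by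
  have has := hasSubst_axisCurve (k := k) w
  have h1 : subst (axisCurve (k := k) w) (1 : MvPowerSeries (Fin (n + 1 + 1)) k) = 1 := by
    rw [← coe_substAlgHom has, map_one]
  funext i
  refine Fin.lastCases ?_ (fun j => ?_) i
  · rw [snoc_scaleFam_last, subst_X has]
  · rw [snoc_scaleFam_castSucc, subst_mul has, subst_pow has, subst_add has, h1, subst_X has, subst_X has]
    by_cases hw : Fin.castSucc j = w
    · have hl : Fin.last (n + 1) ≠ w := by rw [← hw]; exact (Fin.castSucc_lt_last j).ne'
      unfold axisCurve
      rw [if_neg hl, add_zero, one_pow, one_mul]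
    · unfold axisCurve
      rw [if_neg hw, mul_zero]

/-! ## COVER EXACT -/

/-- **COVER EXACT** (idea-1 ROUND-6 (a)).  For the Frobenius-cover normal form `G̃ = (1+t)ᵃ · h((1+t)^K x)`, `t = X last`,
`p ≠ 0`: `G̃` is Fix-twisted-trivial along the axis direction `w` iff `w = t`, or `w = xᵢ` and `h` is Fix-twisted-trivial
along `xᵢ`.  In the ideator's notation: `satDir p G̃ = {t} ∪ castSucc (satDir p h)`. [OURS · L1 W4.3] -/
theorem twistedTrivialAlongFix_coverForm_axis_iff (p : ℕ) (hp : p ≠ 0) (K : Fin (n + 1) → ℕ) (a : ℕ)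
    (h : MvPowerSeries (Fin (n + 1)) k) (w : Fin (n + 1 + 1)) :
    TwistedTrivialAlongFix p ((1 + X (Fin.last (n + 1))) ^ a * subst (scaleFam (k := k) K) h) (axisCurve w) ↔
      w = Fin.last (n + 1) ∨ ∃ i : Fin (n + 1), w = Fin.castSucc i ∧ TwistedTrivialAlongFix p h (axisCurve i) := by
  have hu : IsUnit (((1 + X (Fin.last (n + 1))) ^ a : MvPowerSeries (Fin (n + 1 + 1)) k)) := by
    refine IsUnit.pow a (MvPowerSeries.isUnit_iff_constantCoeff.mpr ?_)
    rw [map_add, map_one, constantCoeff_X, add_zero]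
    exact isUnit_one
  rw [twistedTrivialAlongFix_unit_mul_iff p hp _ _ hu, ← subst_snoc_scaleFam_cylinder K h,
    twistedTrivialAlongFix_subst_iff p hp (cylinder h) _ (constantCoeff_snoc_scaleFam K)
      (isUnit_det_linMat_snoc_scaleFam K) _ (constantCoeff_axisCurve w),
    subst_axisCurve_snoc_scaleFam K w, twistedTrivialAlongFix_cylinder_iff p hp h w]

/-- COVER EXACT in res-type-060's TC language: if `subst (frobFamily n q) G = (1 + X last)^a * subst (scaleFam K) h`
(`G` a twisted cylinder over `h`), the pull-back `G(x, t^q)` of `G` to the `μ_q`-cover is Fix-twisted-trivial along the axis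
direction `w` iff `w = t` or `w = xᵢ` with `h` Fix-twisted-trivial along `xᵢ`. [OURS · L1 W4.3] -/
theorem twistedTrivialAlongFix_twistedCyl_axis_iff (p : ℕ) (hp : p ≠ 0) (q : ℕ) (K : Fin (n + 1) → ℕ) (a : ℕ)
    (h : MvPowerSeries (Fin (n + 1)) k) (G : MvPowerSeries (Fin (n + 1 + 1)) k)
    (hTC : subst (frobFamily (k := k) n q) G = (1 + X (Fin.last (n + 1))) ^ a * subst (scaleFam (k := k) K) h)
    (w : Fin (n + 1 + 1)) :
    TwistedTrivialAlongFix p (subst (frobFamily (k := k) n q) G) (axisCurve w) ↔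
      w = Fin.last (n + 1) ∨ ∃ i : Fin (n + 1), w = Fin.castSucc i ∧ TwistedTrivialAlongFix p h (axisCurve i) := by
  rw [hTC]
  exact twistedTrivialAlongFix_coverForm_axis_iff p hp K a h w

/-- **COVER EXACT AT THE WILD POINT.**  Frozen coordinate `v` = last with `0 < w_v`, `q ∣ w_v`, `q ∣ wⱼ` for every translated
`j ≠ v`, and `(1 + y_v)^q = 1 + y_v^q` in `k⟦s, y⟧` (e.g. `q = p^e` in characteristic `p`): for the `s`-saturated successor
`g` (`F'(chart_c) = sᵃ·g`), the pull-back `(g ∘ Λ_q)(s, y', y_v^q)` of the renormalised successor to the `μ_q`-cover is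
Fix-twisted-trivial (exponent base `p ≠ 0`) along the axis direction `u` iff `u = v`, or `u = castSucc i` and the SLICE
`g|_{y_v=0}` is Fix-twisted-trivial along `i`. [OURS · L1 W4.3] -/
theorem twistedTrivialAlongFix_wildCover_axis_iff (w : Fin (n + 1) → ℕ) (c : Fin (n + 1) → k) (q : ℕ) (hq : 0 < q)
    (hfrob : ((1 : MvPowerSeries (Fin (n + 1 + 1)) k) + X (Fin.last (n + 1))) ^ q = 1 + X (Fin.last (n + 1)) ^ q)
    (hw : 0 < w (Fin.last n)) (hv : q ∣ w (Fin.last n)) (hmin : ∀ j, j ≠ Fin.last n → c j ≠ 0 → q ∣ w j)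
    (F' : MvPowerSeries (Fin (n + 1)) k) (a : ℕ) (g : MvPowerSeries (Fin (n + 1 + 1)) k)
    (hfac : subst (CobordantGame.cruxChart k w c) F' = X 0 ^ a * g) (p : ℕ) (hp : p ≠ 0) (u : Fin (n + 1 + 1)) :
    TwistedTrivialAlongFix p (subst (frobFamily (k := k) n q) (subst (wildLambda w c q) g)) (axisCurve u) ↔
      u = Fin.last (n + 1) ∨
        ∃ i : Fin (n + 1), u = Fin.castSucc i ∧ TwistedTrivialAlongFix p (sliceGerm (Fin.last n) g) (axisCurve i) := by
  rw [subst_frobFamily_wildLambda_eq_scaleFam w c q hq hfrob hw hv hmin F' a g hfac]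
  exact twistedTrivialAlongFix_coverForm_axis_iff p hp _ a _ u

end GradedGame

end Summit.ResolutionOfSingularities.ResolutionOfSingularities.Theorems
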